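import Summits.MatrixMultiplication.MatrixMultiplication.Theorems.SaturationLadderTowerChain
import HarnessLib

/-!
# Route `SaturationLadder` on Strassen's spectrum, XVI: THE PLATEAUX OF THE ISOLATED SQUARING TOWER — a convergent ladder and its ceiling

decomp-mm lens 1 «grading / quantitative ladder», gen 49, kernel K49-C+ (part 2 of 2; part 1 = `SaturationLadderTowerChain`).
Def-free, sorry-free support module beneath the deciding crux `SubexpSaturation` (stmt-MatrixMultiplication-25909) of
`route-MatrixMultiplication-SaturationLadder`; cut of record UNCHANGED (`closes (h₁ : SubexpSaturation) (h₂ : SubexpToPoly)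
(h₃ : PolyToFinite) (h₄ : TailDescentTwo) (h₅ : SquareFromTwo)`).

Part 1 (`thinTowerChain`) makes every stage `j` of route `FarEdgeDescent`'s isolated squaring tower from an OUTPUT-PERFECT
start an exact thin roof `B_j·θ₁ ≤ A_j·(ε₀ + ε₂)` over every field, with `A_{j+1} = 2r_jA_j`,
`B_{j+1} = 2r_jB_j − 2 log Q_j + log Q_{j+1}`, `Q_{j+1} = Q_j² + 2L_j²`.  This part reads the recursion:
* §1 (`ladder_arith`, pure arithmetic; `plateau_of_roof`): with `L₀ ≥ 1`, `A₀ > 0`, `r₀ ≤ 3Q₀` the plateau points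
  `t_j = B_j/A_j` — each an EXACT PLATEAU `ω_K(1,t_j,1) = 2` — INCREASE STRICTLY (`Q_{j+1} > Q_j²`), while the potential
  `(B_j + c)/A_j`, `c = log 3/(2r₀ − 1)`, is NON-INCREASING (`r_j ≤ 3Q_j ⟹ Q_{j+1} ≤ 3Q_j²`, `A_{j+1} ≥ 2r₀A_j`): the whole
  ladder above stage `j₀` lives in the certified WINDOW `[t_{j₀}, t_{j₀} + c/A_{j₀}]` — the tower is CAPPED in the thin
  currency, with a two-sided bound on its limit at every stage (a convergent ladder is an ILLUSTRATION and a CEILING, not a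
  road to `h₁`, which needs `t ↑ 1`: K48-P `subexpSaturation_of_roofSequence`).
* §2 Schönhage's `E₃` (`⟨1,4,1⟩ ⊕ ⟨3,1,3⟩`, `r₀ = 10 = 1 + 3²`, XXXII-D `base_isolated`): `t₀ = log 4/(9 log 3) = 0.14020…`
  (K48-P `plateau_schoenhageE3`), `t₁ = (18 log 4 + log 34)/(180 log 3) = 0.14401…` (`Q₁ = 34`, `r₁ = 100`: the packing
  `⟨1,34,1⟩ ⊕ 2⟨3,4,3⟩ ⊕ ⟨9,1,9⟩`), `t₂ = (3600 log 4 + 198 log 34 + log 3334)/(36000 log 3) = 0.1440451…` (`Q₂ = 3334`,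
  `r₂ = 10⁴`), every `t_j` an exact plateau over every field; windows `t_j ≤ t₁ + 1/3420` (`j ≥ 1`), `t_j ≤ t₂ + 1/684000`
  (`j ≥ 2`); ceiling `t_j < 11/76 < log 4/(5 log 5) = α_C` (`4¹⁸·34 < 3²⁶`, `5⁵⁵ < 4⁷⁶`): the isolated tower never reaches
  Coppersmith's 1982 plateau (`coppersmithExponent`, `coppersmith1982_omegaRect_eq_two`) — numerically `t_j ↑ t_∞ = 0.14404513…`.
  In the shadow coordinates `(σ,τ) = (θ₀+θ₂, θ₁)` of route `FarEdgeDescent`'s kernel XXXIV-A (`FarEdgeDescentFlatCorner`)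
  the stage-`j` roof EXCLUDES `τ > (2−σ)/t_j`: the base slope `9 log 3/log 4 = 7.13… = 1/t₀` and the "tower's own limit
  slope `6.942…`" quoted there are `1/t_j ↓ 1/t_∞ = 6.94226…`, certified here stage by stage with two-sided windows
  (consistent with `flatCorner_pass`: its pass wedge `τ ≤ 3(2−σ)` lies below every roof line).
Tags: `SubexpSaturation` (h₁) NEC-side ladder · WEAKER · ATTACKED; ILLUSTRATION/ceiling.  No defs.
[cite: Schonhage1981, §5] [cite: Pan1984, Props. 16.2–16.5, Thm. 17.1] [cite: Coppersmith1982, Theorem (BCS 1997 Thm. (15.51))]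
[cite: Stothers2010, §1, Thm. 8] [cite: Strassen1988, Thm. 3.8] [cite: CoppersmithWinograd1990, §6]
-/

set_option linter.dupNamespace false

noncomputable section

open scoped BigOperators Polynomial
open Polynomial

namespace Summit.MatrixMultiplication.MatrixMultiplication.Theorems.SaturationLadderTowerPlateaux

open Literature.Computability.AlgebraicComplexity
open Summit.MatrixMultiplication.MatrixMultiplication.Theorems.SaturationLadderThinRoof
open Summit.MatrixMultiplication.MatrixMultiplication.Theorems.SaturationLadderTowerChain

variable (K : Type) [Field K]

/-! ## §1 Arithmetic of the thin recursion: positivity, strict monotonicity, the potential and the windows -/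

/-- **THE THIN LADDER OF THE TOWER** (pure arithmetic of the recursion of `thinTowerChain`).  With `L₀ ≥ 1`, `A₀ > 0`
and `r₀ ≤ 3Q₀`: `L_j ≥ 1`, `A_j > 0`, `Q_{j+1} = Q_j² + 2L_j²`, `r_j ≤ 3Q_j`, `r₀ ≤ r_j`; the plateau points
`t_j = B_j/A_j` INCREASE STRICTLY (`Q_{j+1} > Q_j²`); the potential `(B_j + c)/A_j`, `c = log 3/(2r₀ − 1)`, is
NON-INCREASING (`Q_{j+1} ≤ 3Q_j²`, `A_{j+1} = 2r_jA_j ≥ 2r₀A_j`); hence the two-sided WINDOW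
`t_{j₀} ≤ t_j ≤ t_{j₀} + c/A_{j₀}` for all `j ≥ j₀`. [folklore] [cite: Pan1984, Props. 16.2–16.5] -/
theorem ladder_arith (r Q L : ℕ → ℕ) (A B : ℕ → ℝ)
    (hsum : ∀ j, Q j + 2 * L j = r j) (hL1 : 1 ≤ L 0) (hA0 : 0 < A 0)
    (h3 : r 0 ≤ 3 * Q 0)
    (hL : ∀ j, L (j + 1) = (Q j + L j) ^ 2 - Q j ^ 2) (hr : ∀ j, r (j + 1) = r j ^ 2)
    (hA : ∀ j, A (j + 1) = 2 * (r j : ℝ) * A j)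
    (hB : ∀ j, B (j + 1) = 2 * (r j : ℝ) * B j - 2 * Real.log (Q j) + Real.log (Q (j + 1))) :
    (∀ j, 1 ≤ L j) ∧ (∀ j, 0 < A j) ∧ (∀ j, Q (j + 1) = Q j ^ 2 + 2 * L j ^ 2) ∧
    (∀ j, r j ≤ 3 * Q j) ∧ (∀ j, r 0 ≤ r j) ∧
    (∀ j, B j / A j < B (j + 1) / A (j + 1)) ∧
    (∀ j, (B (j + 1) + Real.log 3 / (2 * r 0 - 1)) / A (j + 1) ≤
      (B j + Real.log 3 / (2 * r 0 - 1)) / A j) ∧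
    (∀ j₀ j, j₀ ≤ j → B j₀ / A j₀ ≤ B j / A j ∧
      B j / A j ≤ B j₀ / A j₀ + Real.log 3 / (2 * r 0 - 1) / A j₀) := by
  have hLexp : ∀ j, L (j + 1) = 2 * Q j * L j + L j ^ 2 := fun j => by
    rw [hL]
    apply Nat.sub_eq_of_eq_add
    ring
  have hQ' : ∀ j, Q (j + 1) = Q j ^ 2 + 2 * L j ^ 2 := fun j => by
    have h1 := hsum (j + 1)
    rw [hr, ← hsum j, hLexp] at h1
    nlinarith [h1]
  have hL1' : ∀ j, 1 ≤ L j := fun j => by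
    induction j with
    | zero => exact hL1
    | succ j ih => rw [hLexp]; nlinarith [ih]
  have hr1 : ∀ j, 1 ≤ r j := fun j => by rw [← hsum j]; nlinarith [hL1' j]
  have hApos : ∀ j, 0 < A j := fun j => by
    induction j with
    | zero => exact hA0
    | succ j ih =>
      rw [hA]
      have : (1 : ℝ) ≤ r j := by exact_mod_cast hr1 j
      positivity
  have h3' : ∀ j, r j ≤ 3 * Q j := fun j => by
    induction j with
    | zero => exact h3
    | succ j ih =>
      rw [hr, hQ', ← hsum j]
      nlinarith [sq_nonneg ((Q j : ℤ) - (L j : ℤ))]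
  have hLQ : ∀ j, L j ≤ Q j := fun j => by have := h3' j; rw [← hsum j] at this; omega
  have hr0 : ∀ j, r 0 ≤ r j := fun j => by
    induction j with
    | zero => exact le_rfl
    | succ j ih => rw [hr]; exact ih.trans (Nat.le_self_pow two_ne_zero _)
  have hQpos : ∀ j, (0 : ℝ) < Q j := fun j => by
    have : 1 ≤ Q j := by have := hsum j; have := hLQ j; have := hL1' j; omega
    exact_mod_cast this
  -- the increment `δ_j = log Q_{j+1} − 2 log Q_j ∈ (0, log 3]`
  have hδpos : ∀ j, 0 < Real.log (Q (j + 1)) - 2 * Real.log (Q j) := fun j => by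
    have h1 : ((Q j : ℕ) : ℝ) ^ 2 < Q (j + 1) := by
      have : Q j ^ 2 < Q (j + 1) := by rw [hQ']; nlinarith [hL1' j]
      exact_mod_cast this
    have h2 := Real.log_lt_log (by have := hQpos j; positivity) h1
    rw [Real.log_pow] at h2
    push_cast at h2
    linarith
  have hδle : ∀ j, Real.log (Q (j + 1)) - 2 * Real.log (Q j) ≤ Real.log 3 := fun j => by
    have h1 : ((Q (j + 1) : ℕ) : ℝ) ≤ 3 * ((Q j : ℕ) : ℝ) ^ 2 := by
      have : Q (j + 1) ≤ 3 * Q j ^ 2 := by rw [hQ']; nlinarith [hLQ j]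
      exact_mod_cast this
    have h2 := Real.log_le_log (hQpos (j + 1)) h1
    rw [Real.log_mul (by norm_num) (by have := hQpos j; positivity), Real.log_pow] at h2
    push_cast at h2
    linarith
  have hden : (0 : ℝ) < 2 * r 0 - 1 := by
    have : (1 : ℝ) ≤ r 0 := by exact_mod_cast hr1 0
    linarith
  have hc0 : 0 ≤ Real.log 3 / (2 * r 0 - 1) :=
    div_nonneg (Real.log_nonneg (by norm_num)) hden.le
  have hc : Real.log 3 / (2 * r 0 - 1) * (2 * r 0 - 1) = Real.log 3 := div_mul_cancel₀ _ hden.ne'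
  -- strict step
  have hstep : ∀ j, B j / A j < B (j + 1) / A (j + 1) := fun j => by
    rw [div_lt_div_iff₀ (hApos j) (hApos (j + 1)), hA, hB]
    have hrpos : (0 : ℝ) < r j := by have := hr1 j; exact_mod_cast this
    nlinarith [mul_pos (mul_pos hrpos (hδpos j)) (hApos j), hApos j]
  -- potential step
  have hpot : ∀ j, (B (j + 1) + Real.log 3 / (2 * r 0 - 1)) / A (j + 1) ≤
      (B j + Real.log 3 / (2 * r 0 - 1)) / A j := fun j => by
    rw [div_le_div_iff₀ (hApos (j + 1)) (hApos j), hA, hB]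
    have hr0j : ((r 0 : ℕ) : ℝ) ≤ r j := by exact_mod_cast hr0 j
    have hs : Real.log (Q (j + 1)) - 2 * Real.log (Q j) + Real.log 3 / (2 * r 0 - 1) ≤
        2 * (r j : ℝ) * (Real.log 3 / (2 * r 0 - 1)) := by
      nlinarith [hδle j, mul_le_mul_of_nonneg_right hr0j hc0]
    nlinarith [mul_le_mul_of_nonneg_right hs (hApos j).le, hApos j]
  refine ⟨hL1', hApos, hQ', h3', hr0, hstep, hpot, fun j₀ j hj => ⟨?_, ?_⟩⟩
  · induction j, hj using Nat.le_induction with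
    | base => exact le_rfl
    | succ j _ ih => exact ih.trans (hstep j).le
  · have hΦ : (B j + Real.log 3 / (2 * r 0 - 1)) / A j ≤ (B j₀ + Real.log 3 / (2 * r 0 - 1)) / A j₀ := by
      induction j, hj using Nat.le_induction with
      | base => exact le_rfl
      | succ j _ ih => exact (hpot j).trans ih
    have h1 : B j / A j ≤ (B j + Real.log 3 / (2 * r 0 - 1)) / A j :=
      div_le_div_of_nonneg_right (by linarith) (hApos j).le
    have h2 : (B j₀ + Real.log 3 / (2 * r 0 - 1)) / A j₀ =
        B j₀ / A j₀ + Real.log 3 / (2 * r 0 - 1) / A j₀ := add_div _ _ _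
    exact h1.trans (hΦ.trans_eq h2)

/-- **Exact roofs are plateaux**: `B·θ₁ ≤ A·(ε₀ + ε₂)` for all universal `φ` with `A > 0`, `B ≥ 0` gives
`ω_K(1, B/A, 1) = 2`. [cite: Strassen1988, Thm. 3.8] [cite: Coppersmith1982, Theorem (BCS 1997 Thm. (15.51))] -/
theorem plateau_of_roof {A B : ℝ} (hA : 0 < A) (hB : 0 ≤ B)
    (h : ∀ F : SpectralMap K, IsUniversalSpectralPoint K F →
      B * specMMPoint K F 1 ≤ A * ((1 - specMMPoint K F 0) + (1 - specMMPoint K F 2))) :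
    omegaRect K 1 (B / A) 1 = 2 := by
  rw [plateau_iff_roof (div_nonneg hB hA.le)]
  intro F hF
  have h1 := h F hF
  rw [div_mul_eq_mul_div, div_le_iff₀ hA]
  linarith

/-! ## §2 Schönhage's `E₃`: the plateaux `t₀ < t₁ < t₂ < …`, their windows, and the ceiling below `α_C` -/

/-- `t₁ < 13/90`: `4¹⁸·34 < 3²⁶`. [folklore] -/
theorem towerStage_one_lt : (18 * Real.log 4 + Real.log 34) / (180 * Real.log 3) < 13 / 90 := by
  have h3 : 0 < Real.log 3 := Real.log_pos (by norm_num)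
  rw [div_lt_div_iff₀ (by positivity) (by norm_num)]
  have h := Real.log_lt_log (by positivity) (show (4 : ℝ) ^ 18 * 34 < 3 ^ 26 by norm_num)
  rw [Real.log_mul (by positivity) (by norm_num), Real.log_pow, Real.log_pow] at h
  push_cast at h
  linarith

/-- `11/76 < α_C = log 4/(5 log 5) = coppersmithExponent` (the tree's Coppersmith plateau `coppersmith1982_omegaRect_eq_two`,
`coppersmithExponent_gt : 0.1722 < α_C`): `5⁵⁵ < 4⁷⁶`. [cite: Coppersmith1982, Theorem (BCS 1997 Thm. (15.51))] -/
theorem eleven_76_lt_coppersmith : (11 : ℝ) / 76 < coppersmithExponent := by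
  have h5 : 0 < Real.log 5 := Real.log_pos (by norm_num)
  rw [coppersmithExponent_eq, div_lt_div_iff₀ (by norm_num) (by positivity)]
  have h := Real.log_lt_log (by positivity) (show (5 : ℝ) ^ 55 < 4 ^ 76 by norm_num)
  rw [Real.log_pow, Real.log_pow] at h
  push_cast at h
  linarith

/-- **THE `E₃` THIN LADDER** over every field `K`: from route `FarEdgeDescent`'s isolated base `⟨1,4,1⟩ ⊕ ⟨3,1,3⟩`
(`r₀ = 10 = 1 + 3²`, output-perfect; XXXII-D `base_isolated`) the tower's plateau points
`t₀ = log 4/(9 log 3) < t₁ = (18 log 4 + log 34)/(180 log 3) < t₂ = (3600 log 4 + 198 log 34 + log 3334)/(36000 log 3) < …`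
are EXACT PLATEAUX `ω_K(1, t_j, 1) = 2`, strictly increasing, confined to the windows `t_j ≤ t₁ + 1/3420` (`j ≥ 1`) and
`t_j ≤ t₂ + 1/684000` (`j ≥ 2`), and capped: `t_j < 11/76 < coppersmithExponent = log 4/(5 log 5)` — the isolated squaring
tower never reaches Coppersmith's 1982 plateau in the thin currency (numerically `t_j ↑ 0.14404513…`, `1/t_∞ = 6.9422…`).
[cite: Schonhage1981, §5] [cite: Pan1984, Props. 16.2–16.5, Thm. 17.1] [cite: Coppersmith1982, Theorem (BCS 1997 Thm. (15.51))]
[cite: CoppersmithWinograd1990, §6] -/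
theorem e3_thinTower :
    ∃ t : ℕ → ℝ,
      t 0 = Real.log 4 / (9 * Real.log 3) ∧
      t 1 = (18 * Real.log 4 + Real.log 34) / (180 * Real.log 3) ∧
      t 2 = (3600 * Real.log 4 + 198 * Real.log 34 + Real.log 3334) / (36000 * Real.log 3) ∧
      StrictMono t ∧
      (∀ j, omegaRect K 1 (t j) 1 = 2) ∧
      (∀ j, 1 ≤ j → t j ≤ t 1 + 1 / 3420) ∧
      (∀ j, 2 ≤ j → t j ≤ t 2 + 1 / 684000) ∧
      (∀ j, t j < 11 / 76) ∧
      (∀ j, t j < coppersmithExponent) := by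
  classical
  obtain ⟨H, u, v, w, d, hreal, hd, himp⟩ := FarEdgeDescentIsolatedTower.base_isolated K
  obtain ⟨r, Q, L, A, B, h0r, h0Q, h0L, h0A, h0B, hsum, -, hL, hr, hA, hB, hB0, hroof⟩ :=
    thinTowerChain K (fun _ : Fin 1 => 3) (fun _ : Fin 1 => 1) (fun _ => by norm_num) (fun _ => le_rfl)
      (Q₀ := 4) (r₀ := 3 * 3 + 1) (h₀ := H) (by norm_num) (by simp) (by simp)
      ⟨u, v, w, d, hreal, hd, himp⟩
  have h3 : 0 < Real.log 3 := Real.log_pos (by norm_num)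
  -- the numbers of stages 0, 1, 2
  have hr0 : r 0 = 10 := by rw [h0r]
  have hQ0 : Q 0 = 4 := h0Q
  have hL0 : L 0 = 3 := by rw [h0L, Fin.sum_univ_one]
  have hA0 : A 0 = 9 * Real.log 3 := by rw [h0A, Fin.sum_univ_one]; push_cast; ring
  have hB0' : B 0 = Real.log 4 := by rw [h0B, Fin.sum_univ_one]; push_cast; simp
  have hL1 : L 1 = 33 := by rw [hL, hQ0, hL0]; norm_num
  have hr1 : r 1 = 100 := by rw [hr, hr0]; norm_num
  have hQ1 : Q 1 = 34 := by have h := hsum 1; rw [hL1, hr1] at h; omega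
  have hA1 : A 1 = 180 * Real.log 3 := by rw [hA, hr0, hA0]; push_cast; ring
  have hB1 : B 1 = 18 * Real.log 4 + Real.log 34 := by
    rw [hB, hr0, hB0', hQ0, hQ1]; push_cast; ring
  have hL2 : L 2 = 3333 := by rw [hL, hQ1, hL1]; norm_num
  have hr2 : r 2 = 10000 := by rw [hr, hr1]; norm_num
  have hQ2 : Q 2 = 3334 := by have h := hsum 2; rw [hL2, hr2] at h; omega
  have hA2 : A 2 = 36000 * Real.log 3 := by rw [hA, hr1, hA1]; push_cast; ring
  have hB2 : B 2 = 3600 * Real.log 4 + 198 * Real.log 34 + Real.log 3334 := by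
    rw [hB, hr1, hB1, hQ1, hQ2]; push_cast; ring
  -- the ladder arithmetic (`L₀ = 3 ≥ 1`, `A₀ = 9 log 3 > 0`, `r₀ = 10 ≤ 12 = 3Q₀`)
  obtain ⟨-, hApos, -, -, -, hstep, -, hwin⟩ := ladder_arith r Q L A B hsum (by rw [hL0]; norm_num)
    (by rw [hA0]; positivity) (by rw [hr0, hQ0]; norm_num) hL hr hA hB
  have ht1 : B 1 / A 1 = (18 * Real.log 4 + Real.log 34) / (180 * Real.log 3) := by rw [hB1, hA1]
  have ht2 : B 2 / A 2 = (3600 * Real.log 4 + 198 * Real.log 34 + Real.log 3334) / (36000 * Real.log 3) := by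
    rw [hB2, hA2]
  have hc1 : Real.log 3 / (2 * (r 0 : ℝ) - 1) / A 1 = 1 / 3420 := by
    rw [hr0, hA1]; push_cast; field_simp; ring
  have hc2 : Real.log 3 / (2 * (r 0 : ℝ) - 1) / A 2 = 1 / 684000 := by
    rw [hr0, hA2]; push_cast; field_simp; ring
  have hwin1 : ∀ j, 1 ≤ j → B j / A j ≤ B 1 / A 1 + 1 / 3420 := fun j hj => by
    have h := (hwin 1 j hj).2; rwa [hc1] at h
  have hwin2 : ∀ j, 2 ≤ j → B j / A j ≤ B 2 / A 2 + 1 / 684000 := fun j hj => by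
    have h := (hwin 2 j hj).2; rwa [hc2] at h
  have hcap : ∀ j, B j / A j < 11 / 76 := fun j => by
    have h1 : B 1 / A 1 < 13 / 90 := by rw [ht1]; exact towerStage_one_lt
    rcases Nat.eq_zero_or_pos j with hj | hj
    · subst hj
      linarith [hstep 0]
    · linarith [hwin1 j hj]
  refine ⟨fun j => B j / A j, by simp only [hB0', hA0], ht1, ht2, strictMono_nat_of_lt_succ hstep,
    fun j => plateau_of_roof K (hApos j) (hB0 j) (hroof j), hwin1, hwin2, hcap,
    fun j => (hcap j).trans eleven_76_lt_coppersmith⟩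

/-- **THE SECOND PLATEAU OF THE TOWER**: `ω_K(1, (18 log 4 + log 34)/(180 log 3), 1) = 2` over every field
(`t₁ = 0.14401…`; stage 1 = the `100`-product output-perfect packing `⟨1,34,1⟩ ⊕ 2⟨3,4,3⟩ ⊕ ⟨9,1,9⟩`). [cite: Pan1984, Props. 16.2–16.5]
[cite: Coppersmith1982, Theorem (BCS 1997 Thm. (15.51))] -/
theorem plateau_towerStage_one :
    omegaRect K 1 ((18 * Real.log 4 + Real.log 34) / (180 * Real.log 3)) 1 = 2 := by
  obtain ⟨t, -, h1, -, -, hpl, -⟩ := e3_thinTower K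
  rw [← h1]
  exact hpl 1

/-- **THE THIRD PLATEAU OF THE TOWER**: `ω_K(1, (3600 log 4 + 198 log 34 + log 3334)/(36000 log 3), 1) = 2` over every
field (`t₂ = 0.1440451…`; stage 2 = the `10⁴`-product output-perfect packing with anchor `⟨1,3334,1⟩`).
[cite: Pan1984, Props. 16.2–16.5] [cite: Coppersmith1982, Theorem (BCS 1997 Thm. (15.51))] -/
theorem plateau_towerStage_two :
    omegaRect K 1 ((3600 * Real.log 4 + 198 * Real.log 34 + Real.log 3334) / (36000 * Real.log 3)) 1 = 2 := by
  obtain ⟨t, -, -, h2, -, hpl, -⟩ := e3_thinTower K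
  rw [← h2]
  exact hpl 2

end Summit.MatrixMultiplication.MatrixMultiplication.Theorems.SaturationLadderTowerPlateaux

end
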